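import Mathlib
import HarnessLib
import Summits.AtomisticToContinuum.FouriersLaw.Theses.JunctionLocality
import Summits.AtomisticToContinuum.FouriersLaw.Theses.StaticAbelianSqueeze
import Summits.AtomisticToContinuum.FouriersLaw.Theorems.JunctionLocalityConductanceLowerBoundAbelFloorFrequently
import Summits.AtomisticToContinuum.FouriersLaw.Theorems.JunctionLocalityConductanceLowerBoundFloorEquivalence

/-!
# The exchange stub (R⁻) of line `abel-floor-exchange` read at the contacts: "the open chains conduct at least as well as the bulk"
(crux `ConductanceLowerBound`, item stmt-AtomisticToContinuum-11749; `--supports`, closes nothing; lead c7)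

Skeleton v3 cuts the crux as (A⁻⁻) ∧ (R⁻): (A⁻⁻) is the bulk statement "not an Abel insulator" (p161612), and (R⁻)
`stub_signedSlowRegularity` — `∀ ε ∃ ν₀ ∀ ν ∈ (0,ν₀)`, eventually in `N`, `−εN ≤ I_N(ν) = ∫₀^∞(1 − e^{−νt})c_N` — is the lower half of
the sibling item (R) `UniformAbelianRegularity` (stmt-13416).  This file gives (R⁻) its kernel-checked PHYSICAL READING, so that the planners see
what the sibling's lower half asserts about the finite chains: it is a CONTACT statement, not a bulk one.

* (C⁻) "OPEN DOMINATES BULK": along every unique steady-state family with response coefficients `D_N`, for every regular shift-invariant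
  bulk witness `(μ_T, D)` and every `ε > 0` there is `ν₀ > 0` such that for all `ν ∈ (0, ν₀)`, eventually in `N`,
  `Â(ν) − ε ≤ T²·D_N`, `Â(ν) = ∫₀^∞ e^{−νt} C_T(t) dt` the bulk Abel-regularised Green–Kubo integral — i.e. NO EXTENSIVE CONTACT
  RESISTANCE: the open chain of length `N` between the two Langevin baths conducts, per unit temperature drop, at least as well as the
  equilibrium bulk predicts at every small Abel frequency (`T²·liminf_N D_N ≥ limsup_{ν↓0} Â(ν)`).
* `openDominatesBulk_of_signedSlowRegularity` : (R⁻) → (C⁻)  ((K) + Abelian split + S3 + `D_N ≥ 0`);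
* `signedSlowRegularity_of_openDominatesBulk` : (C⁻) → (R⁻)  (canonical family, the unconditional regular witness, (K), S3);
* `signedSlowRegularity_iff_openDominatesBulk` : **(R⁻) ↔ (C⁻)**.

So the v3 cut reads: crux ⟸ [the bulk is not an Abel insulator] ∧ [the contacts do not throttle the chain extensively]; the first is the
open positivity problem of the sub-problem, the second is what route JunctionLocality's own language (bounded insertion cost / contact
resistance O(1)) is about — and both are one-sided and rate-free.  References: Kundu–Dhar–Narayan 2009; Bonetto–Lebowitz–Rey-Bellet 2000 §7.
No definitions (the reading (C⁻) is spelled out), no named facts, no sorry.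
-/

noncomputable section

open MeasureTheory Filter Set Topology
open Literature.MathematicalPhysics.KineticTheory.HeatConduction
open Summit.AtomisticToContinuum.FouriersLaw.Theorems
open Summit.AtomisticToContinuum.FouriersLaw.Theorems.AbelThermodynamicLimit.SeriesLawAtEveryLaplaceFrequency

namespace Summit.AtomisticToContinuum.FouriersLaw.Cruxes.ConductanceLowerBound.AbelFloorExchange

/-- **(R⁻) → (C⁻): signed slow regularity gives "open dominates bulk".**  Along the crux's data, at a regular bulk witness:
`(N−1)T²D_N = F_N(ν) + I_N(ν) ≥ (Â(ν) − ε/4)N − (ε/2)N` eventually (S3 + (R⁻)), whence `T²D_N ≥ Â(ν) − ε` (using `D_N ≥ 0` when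
`Â(ν) ≤ ε`). [cite: KunduDharNarayan2009, p. 3] -/
theorem openDominatesBulk_of_signedSlowRegularity
    (hR : ∀ ω₂ lam β γ : ℝ, 0 < ω₂ → 0 < lam → 0 < β → 0 < γ → ∀ T : ℝ, 0 < T →
      ∀ ε : ℝ, 0 < ε → ∃ ν₀ : ℝ, 0 < ν₀ ∧ ∀ ν : ℝ, 0 < ν → ν < ν₀ → ∃ N₀ : ℕ, ∀ N : ℕ, N₀ ≤ N →
        -(ε * N) ≤ ∫ t in Set.Ioi (0:ℝ), (1 - Real.exp (-(ν * t))) *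
          ∫ z, (∑ i : Fin N, (pinnedChain ω₂ lam β γ).bondCurrent N i z) *
            (∫ y, (∑ i : Fin N, (pinnedChain ω₂ lam β γ).bondCurrent N i y)
              ∂((pinnedChain ω₂ lam β γ).transitionKernel N T T t.toNNReal z))
            ∂((pinnedChain ω₂ lam β γ).gibbsMeasure N T)) :
    ∀ ω₂ lam β γ : ℝ, 0 < ω₂ → 0 < lam → 0 < β → 0 < γ →
      (∀ (N : ℕ) (T_L T_R : ℝ), 0 < T_L → 0 < T_R → ∀ μ ν : Measure (PhaseSpace N),
        (pinnedChain ω₂ lam β γ).IsSteadyState N T_L T_R μ → (pinnedChain ω₂ lam β γ).IsSteadyState N T_L T_R ν → μ = ν) →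
      ∀ μ : (N : ℕ) → ℝ → ℝ → Measure (PhaseSpace N),
        (∀ (N : ℕ) (T_L T_R : ℝ), 0 < T_L → 0 < T_R → (pinnedChain ω₂ lam β γ).IsSteadyState N T_L T_R (μ N T_L T_R)) →
      ∀ T : ℝ, 0 < T → ∀ Dn : ℕ → ℝ,
        (∀ N : ℕ, Tendsto (fun δ : ℝ => (pinnedChain ω₂ lam β γ).totalCurrent (μ N (T + δ / 2) (T - δ / 2)) / δ)
          (nhdsWithin 0 {(0 : ℝ)}ᶜ) (nhds (Dn N))) →
      ∀ (μT : Measure ChainConfig) (D : InfiniteChainDynamics (pinnedChain ω₂ lam β γ)),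
        (pinnedChain ω₂ lam β γ).IsChainGibbsMeasure T μT → IsShiftInvariant μT → D.PreservesMeasure μT →
        (∀ t : ℝ, D.HasAbsConvergentCorrelation μT t) →
      ∀ ε : ℝ, 0 < ε → ∃ ν₀ : ℝ, 0 < ν₀ ∧ ∀ ν : ℝ, 0 < ν → ν < ν₀ → ∃ N₀ : ℕ, ∀ N : ℕ, N₀ ≤ N →
        (∫ t in Set.Ioi (0:ℝ), Real.exp (-(ν * t)) * D.currentCorrelation μT t) - ε ≤ T ^ 2 * Dn N := by
  intro ω₂ lam β γ hω hl hβ hγ hU μ hμ T hT Dn hDn μT D' hG hS hP' hAC' ε hε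
  haveI : IsProbabilityMeasure μT := hG.1
  have htight := Literature.MathematicalPhysics.KineticTheory.HeatConduction.oneSiteTight_of_isShiftInvariant (μ := μT) hS
  obtain ⟨_, hss⟩ :=
    OscillatorChain.isShiftInvariant_and_hasSuperstabilityEstimate_of_tight_pinnedChain γ hω hl.le hβ.le hT hG htight
  -- regularise the dynamics (same correlations)
  have horb : ∀ᵐ σ ∂μT, ∀ t : ℝ, D'.flow t σ ∈ (pinnedChain ω₂ lam β γ).bmGood :=
    OscillatorChain.ae_forall_flow_mem_bmGood_pinnedChain γ hω.le hl hβ hss D' hP'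
  obtain ⟨D, hcar, hflow⟩ :=
    GreenKuboContinuation.TemperatureBlindVitaliHurwitz.exists_restrictOrbits D' (pinnedChain ω₂ lam β γ).bmGood
  have hcarsub : D.carrier ⊆ (pinnedChain ω₂ lam β γ).bmGood := by
    intro σ hσ
    rw [hcar] at hσ
    have h0 := hσ.2 0
    rwa [D'.flow_zero σ hσ.1] at h0
  have hP : D.PreservesMeasure μT := by
    refine GreenKuboContinuation.TemperatureBlindVitaliHurwitz.preservesMeasure_of_flow_eq hflow ?_ hP'
    rw [hcar]
    filter_upwards [hP'.1, horb] with σ h1 h2 using ⟨h1, h2⟩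
  have hAC : ∀ t : ℝ, D.HasAbsConvergentCorrelation μT t := fun t => by
    rw [GreenKuboContinuation.TemperatureBlindVitaliHurwitz.hasAbsConvergentCorrelation_iff_of_flow_eq hflow]
    exact hAC' t
  have hcorr : D.currentCorrelation μT = D'.currentCorrelation μT :=
    GreenKuboContinuation.TemperatureBlindVitaliHurwitz.currentCorrelation_eq_of_flow_eq hflow μT
  have hS3 := fixedFrequencyMatching_of_registeredLeaves stub_uniformAnchoredCorrelationTails
    stub_uniformFixedTimeOffsetMatching ω₂ lam β γ hω hl hβ hγ T hT
    (stub_regularDLRUnique ω₂ lam β γ hω hl hβ hγ T hT) μT D hG hS hss hcarsub hP hAC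
  -- (R⁻) at ε/2
  obtain ⟨ν₀, hν₀, hRν⟩ := hR ω₂ lam β γ hω hl hβ hγ T hT (ε / 2) (by positivity)
  refine ⟨ν₀, hν₀, fun ν hν hlt => ?_⟩
  obtain ⟨N₂, hN₂⟩ := hRν ν hν hlt
  set A : ℝ := ∫ t in Ioi (0:ℝ), Real.exp (-(ν * t)) * D.currentCorrelation μT t with hA
  have hev := (hS3 ν hν).eventually (Ioi_mem_nhds (show A - ε / 4 < A by linarith))
  obtain ⟨N₁, hN₁⟩ := Filter.eventually_atTop.mp hev
  refine ⟨max (max N₁ N₂) 2, fun N hN => ?_⟩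
  have hN1 : N₁ ≤ N := le_trans (le_trans (le_max_left _ _) (le_max_left _ _)) hN
  have hN2 : N₂ ≤ N := le_trans (le_trans (le_max_right _ _) (le_max_left _ _)) hN
  have hN3 : 2 ≤ N := le_trans (le_max_right _ _) hN
  have hNge : (2:ℝ) ≤ N := by exact_mod_cast hN3
  have hNpos : (0:ℝ) < N := by linarith
  obtain ⟨cc, hcc⟩ : ∃ cc : ℕ → ℝ → ℝ, cc = fun (N : ℕ) (t : ℝ) =>
      ∫ z, (∑ i : Fin N, (pinnedChain ω₂ lam β γ).bondCurrent N i z) *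
        (∫ y, (∑ i : Fin N, (pinnedChain ω₂ lam β γ).bondCurrent N i y)
          ∂((pinnedChain ω₂ lam β γ).transitionKernel N T T t.toNNReal z))
        ∂((pinnedChain ω₂ lam β γ).gibbsMeasure N T) := ⟨_, rfl⟩
  have hK : IntegrableOn (cc N) (Ioi 0) ∧ ((N : ℝ) - 1) * T ^ 2 * Dn N = ∫ t in Ioi (0 : ℝ), cc N t := by
    simpa only [hcc] using
      StaticAbelianSqueeze.kuboAbelIdentity_holds ω₂ lam β γ hω hl hβ hγ hU μ hμ T hT N (Dn N) (hDn N)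
  have hI : -(ε / 2 * N) ≤ ∫ t in Ioi (0:ℝ), (1 - Real.exp (-(ν * t))) * cc N t := by
    simpa only [hcc] using hN₂ N hN2
  have hF' : A - ε / 4 < (∫ t in Ioi (0:ℝ), Real.exp (-(ν * t)) * cc N t) / N := by
    simpa only [hcc] using hN₁ N hN1
  have hF : (A - ε / 4) * N < ∫ t in Ioi (0:ℝ), Real.exp (-(ν * t)) * cc N t := (lt_div_iff₀ hNpos).mp hF'
  have hsplit := integral_abelSplit (cc N) ν hν hK.1
  have key : (A - 3 * ε / 4) * N < ((N : ℝ) - 1) * T ^ 2 * Dn N := by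
    rw [hK.2, hsplit]; nlinarith
  -- the original witness has the same Abel integral
  have hAeq : (∫ t in Ioi (0:ℝ), Real.exp (-(ν * t)) * D'.currentCorrelation μT t) = A := by
    rw [hA, hcorr]
  rw [hAeq]
  by_cases hcase : A - ε ≤ 0
  · -- `D_N ≥ 0`
    have hDnn : 0 ≤ Dn N :=
      Summit.AtomisticToContinuum.FouriersLaw.Cruxes.ConductanceLowerBound.ForecastSensitivity.response_nonneg
        hω hl hβ hγ hT hU hμ hDn hN3
    have : 0 ≤ T ^ 2 * Dn N := by positivity
    linarith
  · rw [not_le] at hcase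
    have hpos : (0:ℝ) < (N : ℝ) - 1 := by linarith
    have h1 : (A - 3 * ε / 4) * ((N:ℝ) - 1) ≤ (A - 3 * ε / 4) * N := by nlinarith
    have h2 : (A - 3 * ε / 4) * ((N:ℝ) - 1) < ((N : ℝ) - 1) * (T ^ 2 * Dn N) := by
      calc (A - 3 * ε / 4) * ((N:ℝ) - 1) ≤ (A - 3 * ε / 4) * N := h1
        _ < ((N : ℝ) - 1) * T ^ 2 * Dn N := key
        _ = ((N : ℝ) - 1) * (T ^ 2 * Dn N) := by ring
    have h3 : A - 3 * ε / 4 < T ^ 2 * Dn N := by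
      by_contra h4
      rw [not_lt] at h4
      have := mul_le_mul_of_nonneg_left h4 hpos.le
      linarith [mul_comm ((N:ℝ) - 1) (A - 3 * ε / 4)]
    linarith

/-- **(C⁻) → (R⁻): "open dominates bulk" gives signed slow regularity.**  Along the canonical unique steady-state family and the tree's
unconditional regular bulk witness: eventually `T²D_N ≥ Â(ν) − ε/4` ((C⁻)) and `F_N(ν)/N ≤ Â(ν) + ε/4` (S3), so
`I_N(ν) = (N−1)T²D_N − F_N(ν) ≥ −Â(ν) − (ε/2)N + ε/4 ≥ −εN` once `N ≥ 2Â(ν)/ε`. [cite: KunduDharNarayan2009, p. 3] -/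
theorem signedSlowRegularity_of_openDominatesBulk
    (hC : ∀ ω₂ lam β γ : ℝ, 0 < ω₂ → 0 < lam → 0 < β → 0 < γ →
      (∀ (N : ℕ) (T_L T_R : ℝ), 0 < T_L → 0 < T_R → ∀ μ ν : Measure (PhaseSpace N),
        (pinnedChain ω₂ lam β γ).IsSteadyState N T_L T_R μ → (pinnedChain ω₂ lam β γ).IsSteadyState N T_L T_R ν → μ = ν) →
      ∀ μ : (N : ℕ) → ℝ → ℝ → Measure (PhaseSpace N),
        (∀ (N : ℕ) (T_L T_R : ℝ), 0 < T_L → 0 < T_R → (pinnedChain ω₂ lam β γ).IsSteadyState N T_L T_R (μ N T_L T_R)) →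
      ∀ T : ℝ, 0 < T → ∀ Dn : ℕ → ℝ,
        (∀ N : ℕ, Tendsto (fun δ : ℝ => (pinnedChain ω₂ lam β γ).totalCurrent (μ N (T + δ / 2) (T - δ / 2)) / δ)
          (nhdsWithin 0 {(0 : ℝ)}ᶜ) (nhds (Dn N))) →
      ∀ (μT : Measure ChainConfig) (D : InfiniteChainDynamics (pinnedChain ω₂ lam β γ)),
        (pinnedChain ω₂ lam β γ).IsChainGibbsMeasure T μT → IsShiftInvariant μT → D.PreservesMeasure μT →
        (∀ t : ℝ, D.HasAbsConvergentCorrelation μT t) →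
      ∀ ε : ℝ, 0 < ε → ∃ ν₀ : ℝ, 0 < ν₀ ∧ ∀ ν : ℝ, 0 < ν → ν < ν₀ → ∃ N₀ : ℕ, ∀ N : ℕ, N₀ ≤ N →
        (∫ t in Set.Ioi (0:ℝ), Real.exp (-(ν * t)) * D.currentCorrelation μT t) - ε ≤ T ^ 2 * Dn N) :
    ∀ ω₂ lam β γ : ℝ, 0 < ω₂ → 0 < lam → 0 < β → 0 < γ → ∀ T : ℝ, 0 < T →
      ∀ ε : ℝ, 0 < ε → ∃ ν₀ : ℝ, 0 < ν₀ ∧ ∀ ν : ℝ, 0 < ν → ν < ν₀ → ∃ N₀ : ℕ, ∀ N : ℕ, N₀ ≤ N →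
        -(ε * N) ≤ ∫ t in Set.Ioi (0:ℝ), (1 - Real.exp (-(ν * t))) *
          ∫ z, (∑ i : Fin N, (pinnedChain ω₂ lam β γ).bondCurrent N i z) *
            (∫ y, (∑ i : Fin N, (pinnedChain ω₂ lam β γ).bondCurrent N i y)
              ∂((pinnedChain ω₂ lam β γ).transitionKernel N T T t.toNNReal z))
            ∂((pinnedChain ω₂ lam β γ).gibbsMeasure N T) := by
  intro ω₂ lam β γ hω hl hβ hγ T hT ε hε
  -- the canonical steady-state family and its response coefficients
  let μ : (N : ℕ) → ℝ → ℝ → Measure (PhaseSpace N) := fun N a b =>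
    if hab : 0 < a ∧ 0 < b then
      Classical.choose (pinnedChain_exists_isSteadyState hω hl hβ hγ N hab.1 hab.2)
    else 0
  have hμ : ∀ (N : ℕ) (T_L T_R : ℝ), 0 < T_L → 0 < T_R →
      (pinnedChain ω₂ lam β γ).IsSteadyState N T_L T_R (μ N T_L T_R) := by
    intro N T_L T_R hL hR'
    show (pinnedChain ω₂ lam β γ).IsSteadyState N T_L T_R
      (if hab : 0 < T_L ∧ 0 < T_R then
        Classical.choose (pinnedChain_exists_isSteadyState hω hl hβ hγ N hab.1 hab.2) else 0)
    rw [dif_pos ⟨hL, hR'⟩]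
    exact Classical.choose_spec (pinnedChain_exists_isSteadyState hω hl hβ hγ N hL hR')
  have hU : ∀ (N : ℕ) (T_L T_R : ℝ), 0 < T_L → 0 < T_R → ∀ ρ ρ' : Measure (PhaseSpace N),
      (pinnedChain ω₂ lam β γ).IsSteadyState N T_L T_R ρ →
      (pinnedChain ω₂ lam β γ).IsSteadyState N T_L T_R ρ' → ρ = ρ' :=
    Summit.AtomisticToContinuum.FouriersLaw.Theses.JunctionLocality.NessUnique_holds ω₂ lam β γ hω hl hβ hγ
  have hDex := FourierGreenKubo.finiteResponse_of_unique ω₂ lam β γ hω hl hβ hγ hU μ hμ T hT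
  choose Dn hDn using hDex
  -- the unconditional regular witness
  obtain ⟨μT, D, hG, hS, -, hcar, hP, -, hAC⟩ :=
    NonBallistic.stub_infiniteVolumeWitness ω₂ lam β γ hω hl hβ hγ T hT
  haveI : IsProbabilityMeasure μT := hG.1
  have htight := Literature.MathematicalPhysics.KineticTheory.HeatConduction.oneSiteTight_of_isShiftInvariant (μ := μT) hS
  obtain ⟨_, hss⟩ :=
    OscillatorChain.isShiftInvariant_and_hasSuperstabilityEstimate_of_tight_pinnedChain γ hω hl.le hβ.le hT hG htight
  have hS3 := fixedFrequencyMatching_of_registeredLeaves stub_uniformAnchoredCorrelationTails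
    stub_uniformFixedTimeOffsetMatching ω₂ lam β γ hω hl hβ hγ T hT
    (stub_regularDLRUnique ω₂ lam β γ hω hl hβ hγ T hT) μT D hG hS hss hcar hP hAC
  -- (C⁻) at ε/4
  obtain ⟨ν₀, hν₀, hCν⟩ := hC ω₂ lam β γ hω hl hβ hγ hU μ hμ T hT Dn hDn μT D hG hS hP hAC (ε / 4) (by positivity)
  refine ⟨ν₀, hν₀, fun ν hν hlt => ?_⟩
  obtain ⟨N₁, hN₁⟩ := hCν ν hν hlt
  set A : ℝ := ∫ t in Ioi (0:ℝ), Real.exp (-(ν * t)) * D.currentCorrelation μT t with hA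
  have hev := (hS3 ν hν).eventually (Iio_mem_nhds (show A < A + ε / 4 by linarith))
  obtain ⟨N₂, hN₂⟩ := Filter.eventually_atTop.mp hev
  obtain ⟨N₃, hN₃⟩ := exists_nat_ge (2 * A / ε)
  refine ⟨max (max N₁ N₂) (max N₃ 2), fun N hN => ?_⟩
  have hNa : N₁ ≤ N := le_trans (le_trans (le_max_left _ _) (le_max_left _ _)) hN
  have hNb : N₂ ≤ N := le_trans (le_trans (le_max_right _ _) (le_max_left _ _)) hN
  have hNc : N₃ ≤ N := le_trans (le_trans (le_max_left _ _) (le_max_right _ _)) hN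
  have hNd : 2 ≤ N := le_trans (le_trans (le_max_right _ _) (le_max_right _ _)) hN
  have hNge : (2:ℝ) ≤ N := by exact_mod_cast hNd
  have hNpos : (0:ℝ) < N := by linarith
  have hN3r : 2 * A / ε ≤ N := le_trans hN₃ (by exact_mod_cast hNc)
  obtain ⟨cc, hcc⟩ : ∃ cc : ℕ → ℝ → ℝ, cc = fun (N : ℕ) (t : ℝ) =>
      ∫ z, (∑ i : Fin N, (pinnedChain ω₂ lam β γ).bondCurrent N i z) *
        (∫ y, (∑ i : Fin N, (pinnedChain ω₂ lam β γ).bondCurrent N i y)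
          ∂((pinnedChain ω₂ lam β γ).transitionKernel N T T t.toNNReal z))
        ∂((pinnedChain ω₂ lam β γ).gibbsMeasure N T) := ⟨_, rfl⟩
  have hK : IntegrableOn (cc N) (Ioi 0) ∧ ((N : ℝ) - 1) * T ^ 2 * Dn N = ∫ t in Ioi (0 : ℝ), cc N t := by
    simpa only [hcc] using
      StaticAbelianSqueeze.kuboAbelIdentity_holds ω₂ lam β γ hω hl hβ hγ hU μ hμ T hT N (Dn N) (hDn N)
  have hDge : A - ε / 4 ≤ T ^ 2 * Dn N := hN₁ N hNa
  have hF' : (∫ t in Ioi (0:ℝ), Real.exp (-(ν * t)) * cc N t) / N < A + ε / 4 := by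
    simpa only [hcc] using hN₂ N hNb
  have hF : (∫ t in Ioi (0:ℝ), Real.exp (-(ν * t)) * cc N t) < (A + ε / 4) * N := (div_lt_iff₀ hNpos).mp hF'
  have hsplit := integral_abelSplit (cc N) ν hν hK.1
  -- I_N = (N−1)T²D_N − F_N
  have hIeq : (∫ t in Ioi (0:ℝ), (1 - Real.exp (-(ν * t))) * cc N t) =
      ((N : ℝ) - 1) * T ^ 2 * Dn N - ∫ t in Ioi (0:ℝ), Real.exp (-(ν * t)) * cc N t := by
    rw [hK.2, hsplit]; ring
  have hprod : ((N:ℝ) - 1) * (A - ε / 4) ≤ ((N : ℝ) - 1) * (T ^ 2 * Dn N) :=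
    mul_le_mul_of_nonneg_left hDge (by linarith)
  have hAN : 2 * A ≤ ε * N := by
    have := (div_le_iff₀ hε).mp hN3r
    linarith [mul_comm (N:ℝ) ε]
  have goal : -(ε * N) ≤ ∫ t in Ioi (0:ℝ), (1 - Real.exp (-(ν * t))) * cc N t := by
    rw [hIeq]; nlinarith
  simpa only [hcc] using goal

/-- **(R⁻) ↔ (C⁻): the exchange stub of the line IS "no extensive contact resistance".**  The registered stub `stub_signedSlowRegularity`
(lower half of stmt-13416) holds iff along every unique steady-state family the open chains' response `T²·D_N` asymptotically dominates the
bulk's Abel-regularised Green–Kubo integral at every small frequency (`T²·liminf_N D_N ≥ limsup_{ν↓0} Â(ν)`), at every regular shift-invariant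
bulk witness. [cite: KunduDharNarayan2009, p. 3] -/
theorem signedSlowRegularity_iff_openDominatesBulk :
    (∀ ω₂ lam β γ : ℝ, 0 < ω₂ → 0 < lam → 0 < β → 0 < γ → ∀ T : ℝ, 0 < T →
      ∀ ε : ℝ, 0 < ε → ∃ ν₀ : ℝ, 0 < ν₀ ∧ ∀ ν : ℝ, 0 < ν → ν < ν₀ → ∃ N₀ : ℕ, ∀ N : ℕ, N₀ ≤ N →
        -(ε * N) ≤ ∫ t in Set.Ioi (0:ℝ), (1 - Real.exp (-(ν * t))) *
          ∫ z, (∑ i : Fin N, (pinnedChain ω₂ lam β γ).bondCurrent N i z) *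
            (∫ y, (∑ i : Fin N, (pinnedChain ω₂ lam β γ).bondCurrent N i y)
              ∂((pinnedChain ω₂ lam β γ).transitionKernel N T T t.toNNReal z))
            ∂((pinnedChain ω₂ lam β γ).gibbsMeasure N T)) ↔
    (∀ ω₂ lam β γ : ℝ, 0 < ω₂ → 0 < lam → 0 < β → 0 < γ →
      (∀ (N : ℕ) (T_L T_R : ℝ), 0 < T_L → 0 < T_R → ∀ μ ν : Measure (PhaseSpace N),
        (pinnedChain ω₂ lam β γ).IsSteadyState N T_L T_R μ → (pinnedChain ω₂ lam β γ).IsSteadyState N T_L T_R ν → μ = ν) →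
      ∀ μ : (N : ℕ) → ℝ → ℝ → Measure (PhaseSpace N),
        (∀ (N : ℕ) (T_L T_R : ℝ), 0 < T_L → 0 < T_R → (pinnedChain ω₂ lam β γ).IsSteadyState N T_L T_R (μ N T_L T_R)) →
      ∀ T : ℝ, 0 < T → ∀ Dn : ℕ → ℝ,
        (∀ N : ℕ, Tendsto (fun δ : ℝ => (pinnedChain ω₂ lam β γ).totalCurrent (μ N (T + δ / 2) (T - δ / 2)) / δ)
          (nhdsWithin 0 {(0 : ℝ)}ᶜ) (nhds (Dn N))) →
      ∀ (μT : Measure ChainConfig) (D : InfiniteChainDynamics (pinnedChain ω₂ lam β γ)),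
        (pinnedChain ω₂ lam β γ).IsChainGibbsMeasure T μT → IsShiftInvariant μT → D.PreservesMeasure μT →
        (∀ t : ℝ, D.HasAbsConvergentCorrelation μT t) →
      ∀ ε : ℝ, 0 < ε → ∃ ν₀ : ℝ, 0 < ν₀ ∧ ∀ ν : ℝ, 0 < ν → ν < ν₀ → ∃ N₀ : ℕ, ∀ N : ℕ, N₀ ≤ N →
        (∫ t in Set.Ioi (0:ℝ), Real.exp (-(ν * t)) * D.currentCorrelation μT t) - ε ≤ T ^ 2 * Dn N) :=
  ⟨openDominatesBulk_of_signedSlowRegularity, signedSlowRegularity_of_openDominatesBulk⟩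

end Summit.AtomisticToContinuum.FouriersLaw.Cruxes.ConductanceLowerBound.AbelFloorExchange

end
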